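import Mathlib.NumberTheory.NumberField.InfinitePlace.TotallyRealComplex
import Mathlib.GroupTheory.Perm.Cycle.Type
import HarnessLib

/-!
# A totally complex number field has even degree over every totally real subfield

Layer `Literature/NumberTheory/NumberFields`. THEOREM ONLY (no definition, no named fact): for number fields
`F ⊆ K` with `F` totally real and `K` totally complex, `[K : F]` is even. Proof: fix a (real) embedding
`ι : F → ℂ`; the `[K : F]` embeddings `K → ℂ` over `ι` (`AlgHom.card`) are permuted by complex conjugation
(an `F`-algebra map of `ℂ`, since `ι` is real), an involution WITHOUT fixed points (a fixed embedding would be a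
real embedding of `K`), so their number is even (`Equiv.Perm.exists_fixed_point_of_prime` at `p = 2`). Mathlib has
the Galois case (`NumberField.InfinitePlace.even_finrank_of_not_isUnramified`); this is the general one.
Requested by the cell hodge-nonav (Sketch P1AK-CELLS «PARITY», planner p1 g38): with `K = ℚ(μ_N)|_T` cut out by a
finite group of Hodge isometries and `F` the real-multiplication field, `dim_F T = [K:F] · dim_K T` is even.

## References

* [Neukirch1999] J. Neukirch, *Algebraic Number Theory* (1999), Ch. III §3 (real and complex primes; a complex
  prime of `K` over a real prime of `F` contributes `2` to `Σ e_𝔓 f_𝔓 = [K : F]`).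
-/

namespace Literature.NumberTheory.NumberFields

open NumberField Module

/-- **A totally complex number field has even degree over a totally real subfield**: for number fields `F ⊆ K`,
`F` totally real and `K` totally complex, `Even [K : F]` (each real place of `F` lies under `[K:F]/2` complex places
of `K`; equivalently complex conjugation is a fixed-point-free involution of the `[K:F]` embeddings of `K` over a
real embedding of `F`). [cite: Neukirch1999, Ch. III §3] -/
theorem even_finrank_of_isTotallyReal_of_isTotallyComplex (F K : Type*) [Field F] [NumberField F] [Field K]
    [NumberField K] [Algebra F K] [IsTotallyReal F] [IsTotallyComplex K] : Even (finrank F K) := by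
  classical
  -- a real embedding `ι` of `F`, making `ℂ` an `F`-algebra on which complex conjugation is `F`-linear
  obtain ⟨ι⟩ : Nonempty (F →+* ℂ) := inferInstance
  have hι : ComplexEmbedding.IsReal ι := IsTotallyReal.complexEmbedding_isReal ι
  have hιr : ∀ r : F, starRingEnd ℂ (ι r) = ι r := fun r => RingHom.congr_fun hι r
  letI : Algebra F ℂ := ι.toAlgebra
  haveI : Module.Finite F K := Module.Finite.of_restrictScalars_finite ℚ F K
  let cj : ℂ →ₐ[F] ℂ := { starRingEnd ℂ with commutes' := fun r => hιr r }
  -- `σ ↦ conj ∘ σ` is an involution of the `F`-embeddings `K → ℂ`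
  let f : (K →ₐ[F] ℂ) → (K →ₐ[F] ℂ) := fun σ => cj.comp σ
  have hf : Function.Involutive f := by
    intro σ
    ext x
    show starRingEnd ℂ (starRingEnd ℂ (σ x)) = σ x
    exact Complex.conj_conj _
  have hσ2 : hf.toPerm f ^ 2 ^ 1 = 1 := by
    rw [pow_one, sq]
    exact Equiv.ext fun τ => hf τ
  -- of odd order it would have a fixed point: a REAL embedding of the totally complex field `K`
  by_contra hodd
  rw [even_iff_two_dvd, ← AlgHom.card F K ℂ] at hodd
  haveI : Fact (Nat.Prime 2) := ⟨Nat.prime_two⟩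
  obtain ⟨τ, hτ⟩ := Equiv.Perm.exists_fixed_point_of_prime hodd hσ2
  refine IsTotallyComplex.complexEmbedding_not_isReal (τ : K →+* ℂ) ?_
  rw [ComplexEmbedding.isReal_iff]
  ext x
  exact congrArg (fun ν : K →ₐ[F] ℂ => ν x) hτ

end Literature.NumberTheory.NumberFields
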